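import Summits.CriticalPhenomena.PercolationContinuityZ3.Theorems.PercNearOneGluingNoHeavyLowerTailCILCutObserverBlobTools
import HarnessLib

/-!
# `NoHeavyLowerTail` (stmt-CriticalPhenomena-4575) — the cumulative isolation lemma for a cut observer, II:
# glued root blob and multi-edge glued ports (every blob tree with relay-free root)

Support file (prover `prim-gen-induct`, strategy "induction on the blob quotient"; `--supports
stmt-CriticalPhenomena-4575`).  No definitions, no named facts, no sorries.

`cumulativeIsolation_cutObserver_blob` extends `Theorems.cumulativeIsolation_cutObserver` (bare cut vertex,
one edge per branch) to the natural blob setting: the observer sits in a weight-1 clique `R` (its blob, relay-free),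
every branch `V l` has a weight-1 PORT CLIQUE `P l ⊆ V l ∩ A`, the root blob is attached to `P l` by an arbitrary
bundle of weighted edges `{s(r,v) : r ∈ R, v ∈ P l}`, no positive-weight edge joins `R` to a branch outside its port
or two different branches, and branch interiors are arbitrary.  Conclusion: for every level `j` some relay `a`
(a port vertex) has `μ{1 ≤ N ≤ j} ≤ μ{|π(a)| ≤ j}` — the registered stub `stub_cumulativeIsolation` on this class,
for every `|A|` and every number of branches/blobs.  In the blob-structure language of `…CILFourBlobs` this is CIL for
every BLOB TREE whose root blob contains the observer and no relay (the case of a root blob WITH a relay is the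
equality case `CILBlobs.cil_of_glued`), with no bound on the number of blobs.

Proof: identical root recursion — with `X_l = {some bundle edge of branch l open}`, `M_l` = relay mass of the port's
cluster inside `V l`, the pairs (`X_l`, `M_l`) are independent across branches, `N = Σ_l 𝟙[X_l] M_l` on the full-measure
event "nonzero-weight edges only, weight-1 edges open", and the telescoping inequality `CutObserver.prod_sub_prod_le`
bounds `μ{1 ≤ N ≤ j, X_iᶜ}` by `μ(X_iᶜ)·μ{M_i ≤ j}` for the port `i` maximising `μ{M_i ≤ j}`.
-/

noncomputable section

namespace Summit.CriticalPhenomena.PercolationContinuityZ3.Theorems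

open MeasureTheory Set Literature.Probability.LatticeModels Literature.Probability.Percolation
open scoped Classical BigOperators

variable {n : ℕ}

namespace CutObserver

section BlobGeometry

variable (w : Sym2 (Fin n) → unitInterval) (A R : Finset (Fin n)) (o : Fin n) {d : ℕ}
  (V P : Fin d → Finset (Fin n)) (q : Fin d → Fin n)

/-- Branches are closed off their bundle (blob version of `branch_closed`). [folklore] -/
theorem branch_closed_blob (hPV : ∀ l, P l ⊆ V l) (hRV : ∀ l, Disjoint R (V l))
    (hdisj : ∀ l l', l ≠ l' → Disjoint (V l) (V l'))
    (hcover : ∀ v, v ∉ R → ∃ l, v ∈ V l)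
    (hobs : ∀ r ∈ R, ∀ v, v ∉ R → w s(r, v) ≠ 0 → ∃ l, v ∈ P l)
    (hsep : ∀ l l', l ≠ l' → ∀ u ∈ V l, ∀ v ∈ V l', w s(u, v) = 0)
    (i : Fin d) (ω : BondConfig (Fin n)) (hG : ∀ e ∈ ω, w e ≠ 0)
    (hXi : ∀ e ∈ (R ×ˢ P i).image (fun rv : Fin n × Fin n => s(rv.1, rv.2)), e ∉ ω) :
    ∀ u ∈ (↑(V i) : Set (Fin n)), ∀ v, s(u, v) ∈ ω → u ≠ v → v ∈ (↑(V i) : Set (Fin n)) := by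
  intro u hu v huv hne
  rw [Finset.mem_coe] at hu ⊢
  by_cases hvR : v ∈ R
  · exfalso
    have huR : u ∉ R := fun h => Finset.disjoint_left.1 (hRV i) h hu
    have hw : w s(v, u) ≠ 0 := by rw [Sym2.eq_swap]; exact hG _ huv
    obtain ⟨l, hl⟩ := hobs v hvR u huR hw
    have hli : l = i := by
      by_contra hli
      exact Finset.disjoint_left.1 (hdisj l i hli) (hPV l hl) hu
    subst hli
    refine hXi (s(v, u)) ((mem_bundle_iff R P l _).2 ⟨v, hvR, u, hl, rfl⟩) ?_
    rw [Sym2.eq_swap]; exact huv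
  · obtain ⟨l, hl⟩ := hcover v hvR
    by_cases hli : l = i
    · exact hli ▸ hl
    · exfalso
      exact hG _ huv (hsep i l (Ne.symm hli) u hu v hl)

/-- Off its bundle, the port's cluster is its branch cluster (blob version of `piCard_eq_branchMass`). [folklore] -/
theorem piCard_eq_branchMass_blob (hPV : ∀ l, P l ⊆ V l) (hqP : ∀ l, q l ∈ P l) (hRV : ∀ l, Disjoint R (V l))
    (hdisj : ∀ l l', l ≠ l' → Disjoint (V l) (V l'))
    (hcover : ∀ v, v ∉ R → ∃ l, v ∈ V l)
    (hobs : ∀ r ∈ R, ∀ v, v ∉ R → w s(r, v) ≠ 0 → ∃ l, v ∈ P l)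
    (hsep : ∀ l l', l ≠ l' → ∀ u ∈ V l, ∀ v ∈ V l', w s(u, v) = 0)
    (i : Fin d) (ω : BondConfig (Fin n)) (hG : ∀ e ∈ ω, w e ≠ 0)
    (hXi : ∀ e ∈ (R ×ˢ P i).image (fun rv : Fin n × Fin n => s(rv.1, rv.2)), e ∉ ω) :
    (A.filter fun x => ω ∈ openConn (q i) x).card =
      (A.filter fun x => (openGraph (ω ∩ ↑((V i).sym2))).Reachable (q i) x).card := by
  congr 1
  refine Finset.filter_congr fun x _ => ⟨fun h => ?_, fun h => ?_⟩
  · have hcl := branch_closed_blob w R V P hPV hRV hdisj hcover hobs hsep i ω hG hXi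
    have := reachable_restrict_of_closed ω (↑(V i)) hcl (Finset.mem_coe.2 (hPV i (hqP i))) h
    rwa [coe_sym2_eq]
  · exact reachable_mono inter_subset_left h

/-- On the full-measure event, an open bundle edge of branch `l` joins `o` to every relay of the port's branch
cluster. [folklore] -/
theorem reach_of_bundleOpen (hoR : o ∈ R) (hR1 : ∀ u ∈ R, ∀ v ∈ R, u ≠ v → w s(u, v) = 1)
    (hPV : ∀ l, P l ⊆ V l) (hqP : ∀ l, q l ∈ P l) (hRV : ∀ l, Disjoint R (V l))
    (hP1 : ∀ l, ∀ u ∈ P l, ∀ v ∈ P l, u ≠ v → w s(u, v) = 1)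
    (l : Fin d) (ω : BondConfig (Fin n)) (h1 : ∀ e, w e = 1 → e ∈ ω)
    {e : Sym2 (Fin n)} (he : e ∈ (R ×ˢ P l).image (fun rv : Fin n × Fin n => s(rv.1, rv.2))) (heo : e ∈ ω)
    {x : Fin n} (hx : (openGraph (ω ∩ ↑((V l).sym2))).Reachable (q l) x) :
    (openGraph ω).Reachable o x := by
  obtain ⟨r, hr, v, hv, rfl⟩ := (mem_bundle_iff R P l _).1 he
  have h_or : (openGraph ω).Reachable o r := by
    have := clique_reachable (w := w) h1 R hR1 Set.univ (fun _ _ _ _ => mem_univ _) hoR hr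
    exact reachable_mono inter_subset_left this
  have h_rv : (openGraph ω).Adj r v := by
    rw [openGraph, SimpleGraph.fromEdgeSet_adj]
    exact ⟨heo, fun h => Finset.disjoint_left.1 (hRV l) hr (h ▸ hPV l hv)⟩
  have h_vq : (openGraph ω).Reachable v (q l) := by
    have := clique_reachable (w := w) h1 (P l) (hP1 l) Set.univ (fun _ _ _ _ => mem_univ _) hv (hqP l)
    exact reachable_mono inter_subset_left this
  exact h_or.trans (h_rv.reachable.trans (h_vq.trans (reachable_mono inter_subset_left hx)))

/-- The minority event off the bundle of branch `i` forces some other bundle open and every open bundle light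
(blob version of `bad_offPort_subset`). [folklore] -/
theorem bad_offPort_subset_blob (hoR : o ∈ R) (hRA : Disjoint R A)
    (hR1 : ∀ u ∈ R, ∀ v ∈ R, u ≠ v → w s(u, v) = 1)
    (hPV : ∀ l, P l ⊆ V l) (hqP : ∀ l, q l ∈ P l) (hRV : ∀ l, Disjoint R (V l))
    (hP1 : ∀ l, ∀ u ∈ P l, ∀ v ∈ P l, u ≠ v → w s(u, v) = 1)
    (hobs : ∀ r ∈ R, ∀ v, v ∉ R → w s(r, v) ≠ 0 → ∃ l, v ∈ P l)
    (i : Fin d) (j : ℕ) (ω : BondConfig (Fin n)) (hG : ∀ e ∈ ω, w e ≠ 0) (h1 : ∀ e, w e = 1 → e ∈ ω)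
    (hXi : ∀ e ∈ (R ×ˢ P i).image (fun rv : Fin n × Fin n => s(rv.1, rv.2)), e ∉ ω)
    (hN1 : 1 ≤ (A.filter fun x => ω ∈ openConn o x).card)
    (hNj : (A.filter fun x => ω ∈ openConn o x).card ≤ j) :
    (∀ l ∈ Finset.univ.erase i, (∃ e ∈ (R ×ˢ P l).image (fun rv : Fin n × Fin n => s(rv.1, rv.2)), e ∈ ω) →
        (A.filter fun x => (openGraph (ω ∩ ↑((V l).sym2))).Reachable (q l) x).card ≤ j) ∧
      ¬ (∀ l ∈ Finset.univ.erase i,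
          ∀ e ∈ (R ×ˢ P l).image (fun rv : Fin n × Fin n => s(rv.1, rv.2)), e ∉ ω) := by
  constructor
  · rintro l - ⟨e, he, heo⟩
    refine le_trans (Finset.card_le_card fun x hx => ?_) hNj
    rw [Finset.mem_filter] at hx ⊢
    exact ⟨hx.1, reach_of_bundleOpen w R o V P q hoR hR1 hPV hqP hRV hP1 l ω h1 he heo hx.2⟩
  · intro hall
    obtain ⟨x, hx⟩ := Finset.card_pos.1 (by omega : 0 < (A.filter fun x => ω ∈ openConn o x).card)
    rw [Finset.mem_filter] at hx
    have hxR : x ∉ R := fun h => Finset.disjoint_left.1 hRA h hx.1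
    obtain ⟨r, hr, v, hvR, hrv, hne⟩ := exists_boundary_edge ω (↑R : Set (Fin n))
      (Finset.mem_coe.2 hoR) (fun h => hxR (Finset.mem_coe.1 h)) hx.2
    rw [Finset.mem_coe] at hr
    have hvR' : v ∉ R := fun h => hvR (Finset.mem_coe.2 h)
    obtain ⟨l, hl⟩ := hobs r hr v hvR' (hG _ hrv)
    have hmem : s(r, v) ∈ (R ×ˢ P l).image (fun rv : Fin n × Fin n => s(rv.1, rv.2)) :=
      (mem_bundle_iff R P l _).2 ⟨r, hr, v, hl, rfl⟩
    by_cases hli : l = i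
    · subst hli; exact hXi _ hmem hrv
    · exact hall l (Finset.mem_erase.2 ⟨hli, Finset.mem_univ _⟩) _ hmem hrv

end BlobGeometry

end CutObserver

open CutObserver in
/-- **The cumulative isolation lemma for a cut observer with a glued root blob and glued multi-edge ports**
(every blob tree with relay-free root blob, any number of blobs, any `|A|`, every level).  Data: root clique
`R ∋ o` (weight 1 inside, no relays), branches `V l` partitioning the other vertices, port cliques `P l ⊆ V l ∩ A`
(weight 1 inside) with a chosen port vertex `q l ∈ P l`; hypotheses: the only nonzero-weight edges from `R` to the
outside end in ports, and different branches are not joined by nonzero-weight edges.  Conclusion: some relay `a ∈ A`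
has `μ{1 ≤ N ≤ j} ≤ μ{|π(a)| ≤ j}` (the registered stub `stub_cumulativeIsolation` of crux `NoHeavyLowerTail`,
stmt-CriticalPhenomena-4575, on this class).  Witness: the port `q i` of the branch maximising `μ{M_l ≤ j}`.
[folklore] -/
theorem cumulativeIsolation_cutObserver_blob (w : Sym2 (Fin n) → unitInterval) (A R : Finset (Fin n))
    (o : Fin n) (j : ℕ) {d : ℕ} (V P : Fin d → Finset (Fin n)) (q : Fin d → Fin n)
    (hA : A.Nonempty) (hoR : o ∈ R) (hRA : Disjoint R A)
    (hR1 : ∀ u ∈ R, ∀ v ∈ R, u ≠ v → w s(u, v) = 1)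
    (hPV : ∀ l, P l ⊆ V l) (hqP : ∀ l, q l ∈ P l) (hPA : ∀ l, P l ⊆ A)
    (hP1 : ∀ l, ∀ u ∈ P l, ∀ v ∈ P l, u ≠ v → w s(u, v) = 1)
    (hRV : ∀ l, Disjoint R (V l)) (hdisj : ∀ l l', l ≠ l' → Disjoint (V l) (V l'))
    (hcover : ∀ v, v ∉ R → ∃ l, v ∈ V l)
    (hobs : ∀ r ∈ R, ∀ v, v ∉ R → w s(r, v) ≠ 0 → ∃ l, v ∈ P l)
    (hsep : ∀ l l', l ≠ l' → ∀ u ∈ V l, ∀ v ∈ V l', w s(u, v) = 0) :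
    ∃ a ∈ A,
      (prodBernoulli w).real {ω : BondConfig (Fin n) |
          1 ≤ (A.filter fun x => ω ∈ openConn o x).card ∧
            (A.filter fun x => ω ∈ openConn o x).card ≤ j} ≤
        (prodBernoulli w).real {ω : BondConfig (Fin n) |
          (A.filter fun x => ω ∈ openConn a x).card ≤ j} := by
  haveI : IsProbabilityMeasure (prodBernoulli w) := inferInstance
  -- there is at least one branch
  obtain ⟨a₀, ha₀⟩ := hA
  obtain ⟨l₀, -⟩ := hcover a₀ fun h => Finset.disjoint_left.1 hRA h ha₀
  -- bundles, branch masses and the witness port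
  set F : Fin d → Finset (Sym2 (Fin n)) := fun l =>
    (R ×ˢ P l).image (fun rv : Fin n × Fin n => s(rv.1, rv.2)) with hF
  set M : Fin d → BondConfig (Fin n) → ℕ := fun l ω =>
    (A.filter fun x => (openGraph (ω ∩ ↑((V l).sym2))).Reachable (q l) x).card with hM
  set sl : Fin d → ℝ := fun l => (prodBernoulli w).real {ω : BondConfig (Fin n) | M l ω ≤ j} with hsl
  obtain ⟨i, -, hi⟩ := Finset.exists_max_image Finset.univ sl ⟨l₀, Finset.mem_univ _⟩
  refine ⟨q i, hPA i (hqP i), ?_⟩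
  set bad := {ω : BondConfig (Fin n) | 1 ≤ (A.filter fun x => ω ∈ openConn o x).card ∧
    (A.filter fun x => ω ∈ openConn o x).card ≤ j} with hbad
  set Tgt := {ω : BondConfig (Fin n) | (A.filter fun x => ω ∈ openConn (q i) x).card ≤ j} with hTgt
  set Xi := {ω : BondConfig (Fin n) | ∃ e ∈ F i, e ∈ ω} with hXi
  set Xc : Fin d → Set (BondConfig (Fin n)) := fun l => {ω | ∀ e ∈ F l, e ∉ ω} with hXc
  set NF : Fin d → Set (BondConfig (Fin n)) := fun l => {ω | (∃ e ∈ F l, e ∈ ω) → M l ω ≤ j} with hNF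
  set G := {ω : BondConfig (Fin n) | (∀ e ∈ ω, w e ≠ 0) ∧ ∀ e, w e = 1 → e ∈ ω} with hG
  set T := Finset.univ.erase i with hT
  set b : Fin d → ℝ := fun l => (prodBernoulli w).real (Xc l) with hb
  -- (2a) on the bundle of branch i: π(q i) = π(o)
  have h2a : (prodBernoulli w).real (bad ∩ Xi) ≤ (prodBernoulli w).real (Tgt ∩ Xi) := by
    rw [← measureReal_inter_support₁ w (bad ∩ Xi)]
    refine measureReal_mono (fun ω hω => ?_) (measure_ne_top _ _)
    obtain ⟨⟨⟨_, hj⟩, ⟨e, he, heo⟩⟩, ⟨_, hω1⟩⟩ := hω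
    refine ⟨?_, e, he, heo⟩
    have hoi : (openGraph ω).Reachable o (q i) :=
      reach_of_bundleOpen w R o V P q hoR hR1 hPV hqP hRV hP1 i ω hω1 he heo
        (SimpleGraph.Reachable.refl _)
    show (A.filter fun x => ω ∈ openConn (q i) x).card ≤ j
    have heq : (A.filter fun x => ω ∈ openConn (q i) x) = (A.filter fun x => ω ∈ openConn o x) :=
      Finset.filter_congr fun x _ => ⟨fun h => hoi.trans h, fun h => hoi.symm.trans h⟩
    rw [heq]
    exact hj
  -- (2b) off the bundle of branch i
  have h2b : (prodBernoulli w).real (bad \ Xi) ≤ (prodBernoulli w).real (Tgt \ Xi) := by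
    have hdiff1 : bad \ Xi = bad ∩ Xc i := by
      ext ω; simp only [hXc, hXi, mem_sdiff, mem_inter_iff, mem_setOf_eq, not_exists, not_and]
    have hdiff2 : Tgt \ Xi = Tgt ∩ Xc i := by
      ext ω; simp only [hXc, hXi, mem_sdiff, mem_inter_iff, mem_setOf_eq, not_exists, not_and]
    rw [hdiff1, hdiff2]
    have hQP : (Xc i ∩ ⋂ l ∈ T, Xc l) ⊆ Xc i ∩ ⋂ l ∈ T, NF l := by
      refine inter_subset_inter_right _ (biInter_mono (fun l hl => hl) fun l _ ω hω => ?_)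
      rintro ⟨e, he, heo⟩
      exact absurd heo (hω e he)
    have hsub : (bad ∩ Xc i) ∩ G ⊆ (Xc i ∩ ⋂ l ∈ T, NF l) \ (Xc i ∩ ⋂ l ∈ T, Xc l) := by
      rintro ω ⟨⟨⟨hN1, hNj⟩, hXci⟩, ⟨hωG, hω1⟩⟩
      obtain ⟨hall, hsome⟩ :=
        bad_offPort_subset_blob w A R o V P q hoR hRA hR1 hPV hqP hRV hP1 hobs i j ω hωG hω1 hXci hN1 hNj
      refine ⟨⟨hXci, mem_biInter fun l hl => hall l hl⟩, fun h => hsome fun l hl => ?_⟩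
      exact (mem_iInter₂.1 h.2) l hl
    have hSdisj : (↑T : Set (Fin d)).PairwiseDisjoint fun l => F l ∪ (V l).sym2 :=
      fun k _ k' _ hkk' => bundleSupports_disjoint R V P hPV hRV hdisj hkk'
    have hXci_det : DeterminedBy (Xc i) (⋃ l ∈ T, (↑(F l ∪ (V l).sym2) : Set (Sym2 (Fin n))))ᶜ := by
      refine (determinedBy_bundleClosed (F i)).mono ?_
      intro e he
      rw [Finset.mem_coe] at he
      simp only [mem_compl_iff, mem_iUnion, Finset.mem_coe, not_exists, Finset.mem_union, not_or]
      intro l hl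
      have hli : i ≠ l := (Finset.mem_erase.1 hl).1.symm
      exact ⟨fun h => Finset.disjoint_left.1 (bundle_disjoint_bundle R V P hPV hRV hdisj hli) he h,
        fun h => Finset.disjoint_left.1 (bundle_disjoint_sym2 R V P hRV i l) he h⟩
    have hprodNF : (prodBernoulli w).real (Xc i ∩ ⋂ l ∈ T, NF l) =
        (prodBernoulli w).real (Xc i) * ∏ l ∈ T, (prodBernoulli w).real (NF l) :=
      prodBernoulli_real_inter_biInter_of_determinedBy w T _ hSdisj
        (fun l _ => determinedBy_noHeavy_bundle A (V l) (q l) j (F l))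
        (fun l _ => MeasurableSet.of_discrete) hXci_det MeasurableSet.of_discrete
    have hprodXc : (prodBernoulli w).real (Xc i ∩ ⋂ l ∈ T, Xc l) =
        (prodBernoulli w).real (Xc i) * ∏ l ∈ T, (prodBernoulli w).real (Xc l) :=
      prodBernoulli_real_inter_biInter_of_determinedBy w T _ hSdisj
        (fun l _ => (determinedBy_bundleClosed (F l)).mono (by
          rw [Finset.coe_union]; exact subset_union_left))
        (fun l _ => MeasurableSet.of_discrete) hXci_det MeasurableSet.of_discrete
    have hNFval : ∏ l ∈ T, (prodBernoulli w).real (NF l) = ∏ l ∈ T, (1 - (1 - b l) + (1 - b l) * sl l) := by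
      refine Finset.prod_congr rfl fun l _ => ?_
      rw [show (prodBernoulli w).real (NF l) = b l + (1 - b l) * sl l from
        measureReal_noHeavy_bundle w A (V l) (q l) j (F l) (bundle_disjoint_sym2 R V P hRV l l)]
      ring
    have hXcval : ∏ l ∈ T, (prodBernoulli w).real (Xc l) = ∏ l ∈ T, (1 - (1 - b l)) :=
      Finset.prod_congr rfl fun l _ => by ring
    have hc0 : ∀ l ∈ T, 0 ≤ 1 - b l := fun l _ => by
      have : b l ≤ 1 := measureReal_le_one; linarith
    have hc1 : ∀ l ∈ T, 1 - b l ≤ 1 := fun l _ => by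
      have : 0 ≤ b l := measureReal_nonneg; linarith
    have hs0 : ∀ l ∈ T, 0 ≤ sl l := fun l _ => measureReal_nonneg
    have hsi : ∀ l ∈ T, sl l ≤ sl i := fun l _ => hi l (Finset.mem_univ _)
    have hsi1 : sl i ≤ 1 := measureReal_le_one
    have htel := prod_sub_prod_le T (fun l => 1 - b l) sl (sl i) hc0 hc1 hs0 hsi hsi1
    have hind : (prodBernoulli w).real (Xc i ∩ {ω : BondConfig (Fin n) | M i ω ≤ j}) =
        (prodBernoulli w).real (Xc i) * sl i :=
      prodBernoulli_real_inter_of_determinedBy_disjoint w (bundle_disjoint_sym2 R V P hRV i i)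
        (determinedBy_bundleClosed (F i)) (determinedBy_branchMass A (V i) (q i) j)
        MeasurableSet.of_discrete MeasurableSet.of_discrete
    have hlast : Xc i ∩ {ω : BondConfig (Fin n) | M i ω ≤ j} ∩ G ⊆ Tgt ∩ Xc i := by
      rintro ω ⟨⟨hXci, hMi⟩, ⟨hωG, _⟩⟩
      refine ⟨?_, hXci⟩
      show (A.filter fun x => ω ∈ openConn (q i) x).card ≤ j
      rw [piCard_eq_branchMass_blob w A R V P q hPV hqP hRV hdisj hcover hobs hsep i ω hωG hXci]
      exact hMi
    calc (prodBernoulli w).real (bad ∩ Xc i)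
        = (prodBernoulli w).real ((bad ∩ Xc i) ∩ G) := (measureReal_inter_support₁ w _).symm
      _ ≤ (prodBernoulli w).real ((Xc i ∩ ⋂ l ∈ T, NF l) \ (Xc i ∩ ⋂ l ∈ T, Xc l)) :=
          measureReal_mono hsub (measure_ne_top _ _)
      _ = (prodBernoulli w).real (Xc i ∩ ⋂ l ∈ T, NF l) -
            (prodBernoulli w).real (Xc i ∩ ⋂ l ∈ T, Xc l) :=
          measureReal_sdiff hQP MeasurableSet.of_discrete
      _ = (prodBernoulli w).real (Xc i) *
            (∏ l ∈ T, (1 - (1 - b l) + (1 - b l) * sl l) - ∏ l ∈ T, (1 - (1 - b l))) := by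
          rw [hprodNF, hprodXc, hNFval, hXcval, mul_sub]
      _ ≤ (prodBernoulli w).real (Xc i) * (sl i * (1 - ∏ l ∈ T, (1 - (1 - b l)))) :=
          mul_le_mul_of_nonneg_left htel measureReal_nonneg
      _ ≤ (prodBernoulli w).real (Xc i) * sl i := by
          refine mul_le_mul_of_nonneg_left ?_ measureReal_nonneg
          have hP0 : 0 ≤ ∏ l ∈ T, (1 - (1 - b l)) :=
            Finset.prod_nonneg fun l hl => by linarith [hc1 l hl]
          have : 0 ≤ sl i := measureReal_nonneg
          nlinarith
      _ = (prodBernoulli w).real (Xc i ∩ {ω : BondConfig (Fin n) | M i ω ≤ j}) := hind.symm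
      _ = (prodBernoulli w).real ((Xc i ∩ {ω : BondConfig (Fin n) | M i ω ≤ j}) ∩ G) :=
          (measureReal_inter_support₁ w _).symm
      _ ≤ (prodBernoulli w).real (Tgt ∩ Xc i) := measureReal_mono hlast (measure_ne_top _ _)
  -- assemble
  have hb' := measureReal_inter_add_sdiff (μ := prodBernoulli w) (s := bad)
    (MeasurableSet.of_discrete (s := Xi)) (measure_ne_top _ _)
  have ht' := measureReal_inter_add_sdiff (μ := prodBernoulli w) (s := Tgt)
    (MeasurableSet.of_discrete (s := Xi)) (measure_ne_top _ _)
  linarith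

end Summit.CriticalPhenomena.PercolationContinuityZ3.Theorems

end
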